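import Literature.Algebra.Lie.LefschetzModuleWeylOperatorDegreeZero
import Literature.Algebra.Lie.LefschetzModuleStableSubspaces
import Literature.LinearAlgebra.InternalDirectSumPartialSums
import HarnessLib

/-!
# The Weyl operator on an `𝔰𝔩₂`-submodule: `tr(w | N) = Σ_k χ_k(w) · dim (N ∩ P_{−k})` and `dim N = Σ_k (k + 1) dim (N ∩ P_{−k})`
# for every subspace `N` stable under `e` and `ᶜΛ`

[topic Algebra/Lie]

Topic `Literature/Algebra/Lie` (namespace `Literature.Algebra.Lie.HasLefschetzProperty`).  Lane `lit-hodgefound` (Track 2 foundations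
library), prover seat `lit-hodgefound-p09` (generation 56, row g56-#12).  THEOREMS ONLY (no `def`, no named fact, no instance, no notation;
D-0026 net debt `0`).  `LefschetzPrimitiveDecompositionInternal` (g55-#6) computed `tr w = Σ_m (−1)^m dim P_{−2m}` on the WHOLE module by
the block permutation `(k, i) ↦ (k, k − i)` of `M = ⊕_{k,i} eⁱP_{−k}`; `LefschetzModuleWeylOperatorIsotypicBlocks` (g56-#7/#9) read `w` on the
isotypic blocks and on the sums of blocks (the subspaces stable under `e`, `ᶜΛ` AND the commutant).  This file drops the commutant: by
the tree's `LefschetzModuleStableSubspaces.eq_iSup_map_pow_inf_primitiveSpace_of_stable` EVERY subspace `N` stable under `e` and `ᶜΛ` (an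
`𝔰𝔩₂`-submodule) is the string space `⊕_{k,i} eⁱ(N ∩ P_{−k})` of the primitive family `Q_k = N ∩ P_{−k} ⊆ P_{−k}`, and the block
permutation argument runs verbatim for the blocks `eⁱQ_k` of ANY primitive family `Q_k ⊆ P_{−k}` (§1–§3): `w(eⁱQ_k) = e^{k−i}Q_k`, the
fixed blocks `eᵐQ_{2m}` carry the scalar `(−1)^m`.  Hence **`tr(w | N) = Σ_k χ_k(w) dim (N ∩ P_{−k})`** with Bröcker–tom Dieck's
`χ_{2m}(w) = (−1)^m`, `χ_{2m+1}(w) = 0`, and `dim N = Σ_k (k + 1) dim (N ∩ P_{−k})` (the multiplicity of `V(k)` in `N` is `dim (N ∩ P_{−k})`).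

## Sources, VERBATIM

* Th. Bröcker, T. tom Dieck, *Representations of Compact Lie Groups* (1985) [BrockerTomDieck1985] (held, II §5 p0080): "The character `χ_n` of
  `V_n` has the value `Σ_{k=0}^{n} e^{i(n−2k)t}` at `e(t)`." (the Weyl element is conjugate to `e(π/2)`: `χ_{2m}(w) = (−1)^m`, `χ_{2m+1}(w) = 0`).
* J.-P. Serre, *Linear Representations of Finite Groups* (1977) [Serre1977] (held), §2.1 Prop. 2 (i) (the character of a direct sum) and
  Exercise 2.2 (p0016: "`χ_X(s)` is the number of elements of `X` fixed by `s`").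
* E. Looijenga, V. A. Lunts, *A Lie algebra attached to a projective variety* (1997) [LooijengaLunts1997], §1 (1.6) proof (arXiv p0009 L5:
  "`N = ⊕_{k≥0} ℂ[e] P_{−k}(N)`" for an `𝔰𝔩₂`-submodule `N`) and (1.14) p. 7 ("`M ≅ ⊕_k V(k) ⊗ P_{−k}`").
* R. Goodman, N. R. Wallach, *Symmetry, Representations, and Invariants*, GTM 255 [GoodmanWallachGTM255], §4.1.6 Prop. 4.1.15 (the primary
  decomposition of a completely reducible module and of its submodules).
* Y. André, *Pour une théorie inconditionnelle des motifs* (1996) [Andre1996Motifs], §1.2 (p. 11: the element `(0 1 ; −1 0)` of `SL₂` on the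
  strings).

## What is proved (`Q : ℕ → Submodule K M` with `Q k ≤ primitiveSpace h e k`; `N` a subspace with `e N ⊆ N`, `ᶜΛ N ⊆ N`; `w = L.weylOperator hgr`)

* §1 (blocks of a primitive family) `iSupIndep_map_pow_of_le`, `map_pow_eq_bot_of_lt_of_le`, `map_pow_eq_bot_of_finrank_le_of_le`,
  `finrank_map_pow_of_le` (`dim eⁱQ = dim Q`, `i ≤ k`), **`iSup_iSup_map_pow_eq_biSup_of_le`** (the string space `⊕_{k,i} eⁱQ_k` is the
  FINITE partial sum over `⋃_{k < dim M} {k} × [0, k]`), `finrank_iSup_iSup_map_pow_of_le` (`dim = Σ_{k < dim M} (k+1) dim Q_k`).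
* §2 (`w` on the blocks) `weylOperator_mapsTo_map_pow_of_le` (`w(eⁱQ_k) ⊆ e^{k−i}Q_k`), `weylOperator_apply_of_mem_map_pow_two_mul_of_le`
  (`w = (−1)^m` on `eᵐQ_{2m}`), **`weylOperator_mapsTo_iSup_iSup_map_pow_of_le`** (the string space is `w`-stable).
* §3 **`trace_weylOperator_restrict_iSup_iSup_map_pow_of_le`** — `tr(w | ⊕_{k,i} eⁱQ_k) = Σ_{k < dim M} χ_k(w) dim Q_k`.
* §4 (`𝔰𝔩₂`-SUBMODULES) **`weylOperator_mapsTo_of_stable`**, **`trace_weylOperator_restrict_of_stable`** —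
  `tr(w | N) = Σ_{k < dim M} χ_k(w) dim (N ∩ P_{−k})`, **`finrank_eq_sum_of_stable`** (`dim N = Σ_{k < dim M} (k + 1) dim (N ∩ P_{−k})`),
  `trace_weylOperator_restrict_of_stable_eq_zero` (no even type met ⟹ trace `0`).

## SCOPE

(a) Any field of characteristic `0`; no `√−1` needed.  (b) `N = M` is `LefschetzPrimitiveDecompositionInternal.trace_weylOperator_eq_sum_neg_one_pow`
(up to the parity reindexing), `N = ⊕_{k ∈ S} M[k]` is `LefschetzModuleWeylOperatorIsotypicBlocks` §5–§6 (not restated).  (c) No complex tori here.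
-/

namespace Literature.Algebra.Lie

open Module Finset DirectSum
open Set (MapsTo)
open HasLefschetzProperty (primitiveSpace mem_primitiveSpace_iff)
open Literature.LinearAlgebra

variable {K : Type*} [Field K] [CharZero K] {M : Type*} [AddCommGroup M] [Module K M] [FiniteDimensional K M]
  {h e : Module.End K M}

/-! ### §0 Bookkeeping on the index set `⋃_{k < D} {k} × [0, k]` -/

omit [CharZero K] [FiniteDimensional K M] in
/-- Membership in `{k} × [0, k]`. [folklore] -/
private theorem mem_singleton_product₅₈ {k : ℕ} {p : ℕ × ℕ} : p ∈ ({k} ×ˢ range (k + 1) : Finset (ℕ × ℕ)) ↔ p.1 = k ∧ p.2 ≤ k := by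
  rw [mem_product, mem_singleton, mem_range, Nat.lt_succ_iff]

omit [CharZero K] [FiniteDimensional K M] in
/-- Membership in `⋃_{k < D} {k} × [0, k]`. [folklore] -/
private theorem mem_biUnion₅₈ {D : ℕ} {p : ℕ × ℕ} :
    p ∈ (range D).biUnion (fun k ↦ ({k} ×ˢ range (k + 1) : Finset (ℕ × ℕ))) ↔ p.1 < D ∧ p.2 ≤ p.1 := by
  rw [mem_biUnion]
  constructor
  · rintro ⟨k, hk, hp⟩
    obtain ⟨h1, h2⟩ := mem_singleton_product₅₈.1 hp
    exact ⟨h1 ▸ mem_range.1 hk, h1 ▸ h2⟩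
  · rintro ⟨h1, h2⟩
    exact ⟨p.1, mem_range.2 h1, mem_singleton_product₅₈.2 ⟨rfl, h2⟩⟩

omit [CharZero K] [FiniteDimensional K M] in
/-- The block permutation `(k, i) ↦ (k, k − i)` preserves `⋃_{k < D} {k} × [0, k]`. [folklore] -/
private theorem sigma_mem₅₈ {D : ℕ} : ∀ p ∈ (range D).biUnion (fun k ↦ ({k} ×ˢ range (k + 1) : Finset (ℕ × ℕ))),
    (p.1, p.1 - p.2) ∈ (range D).biUnion (fun k ↦ ({k} ×ˢ range (k + 1) : Finset (ℕ × ℕ))) := fun p hp ↦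
  mem_biUnion₅₈.2 ⟨(mem_biUnion₅₈.1 hp).1, Nat.sub_le p.1 p.2⟩

omit [CharZero K] [FiniteDimensional K M] in
/-- The index sets `{k} × [0, k]` are pairwise disjoint. [folklore] -/
private theorem pairwiseDisjoint₅₈ (S : Finset ℕ) : (S : Set ℕ).PairwiseDisjoint (fun k ↦ ({k} ×ˢ range (k + 1) : Finset (ℕ × ℕ))) :=
  fun _ _ _ _ hkk' ↦ Finset.disjoint_left.2 fun _ hp hp' ↦ hkk' ((mem_singleton_product₅₈.1 hp).1.symm.trans (mem_singleton_product₅₈.1 hp').1)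

namespace HasLefschetzProperty

/-! ### §1 The blocks `eⁱQ_k` of a primitive family `Q_k ⊆ P_{−k}` -/

/-- **The blocks `eⁱQ_k` of a primitive family are independent** (sub-blocks of the independent `eⁱP_{−k}`).
[cite: LooijengaLunts1997, §1 (1.6) proof (arXiv p0009 L5)] [cite: GoodmanWallachGTM255, §4.1.6 Prop. 4.1.15] -/
theorem iSupIndep_map_pow_of_le (L : HasLefschetzProperty h e) (hgr : IsZGrading h) {Q : ℕ → Submodule K M}
    (hQ : ∀ k, Q k ≤ primitiveSpace h e k) : iSupIndep fun p : ℕ × ℕ ↦ (Q p.1).map (e ^ p.2) :=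
  (L.iSupIndep_map_pow_primitiveSpace hgr).mono fun p ↦ Submodule.map_mono (hQ p.1)

omit [CharZero K] [FiniteDimensional K M] in
/-- `eⁱQ_k = 0` for `i > k`. [cite: LooijengaLunts1997, §1 (1.6) proof] -/
theorem map_pow_eq_bot_of_lt_of_le {Q : Submodule K M} {k i : ℕ} (hQ : Q ≤ primitiveSpace h e k) (hki : k < i) : Q.map (e ^ i) = ⊥ :=
  eq_bot_iff.2 ((Submodule.map_mono hQ).trans (map_pow_primitiveSpace_eq_bot_of_lt hki).le)

/-- `eⁱQ_k = 0` for `k ≥ dim M` (no such string type occurs). [cite: LooijengaLunts1997, §1 (1.1) p. 4 (depth ≤ dim)] -/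
theorem map_pow_eq_bot_of_finrank_le_of_le (L : HasLefschetzProperty h e) {Q : Submodule K M} {k : ℕ} (hQ : Q ≤ primitiveSpace h e k)
    (hk : finrank K M ≤ k) (i : ℕ) : Q.map (e ^ i) = ⊥ := by
  rw [eq_bot_iff]
  refine (Submodule.map_mono hQ).trans ?_
  rw [L.primitiveSpace_eq_bot_of_finrank_le hk, Submodule.map_bot]

omit [CharZero K] [FiniteDimensional K M] in
/-- **`dim eⁱQ = dim Q` for `Q ⊆ P_{−k}`, `i ≤ k`** (`eⁱ` is injective on `P_{−k}`). [cite: LooijengaLunts1997, §1 (1.1) p. 4 ("eᵏ maps M_{−k} isomorphically onto M_k")] -/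
theorem finrank_map_pow_of_le (L : HasLefschetzProperty h e) {Q : Submodule K M} {k i : ℕ} (hQ : Q ≤ primitiveSpace h e k) (hi : i ≤ k) :
    finrank K ↥(Q.map (e ^ i)) = finrank K ↥Q := by
  have hinj : Function.Injective ((e ^ i).domRestrict Q) := by
    rw [← LinearMap.ker_eq_bot, Submodule.eq_bot_iff]
    rintro ⟨q, hq⟩ hq0
    rw [LinearMap.mem_ker, LinearMap.domRestrict_apply] at hq0
    have hk0 : (e ^ k) q = 0 := by
      rw [show k = (k - i) + i by omega, pow_add, Module.End.mul_apply, hq0, map_zero]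
    exact Subtype.ext (L.eq_zero_of_pow_apply_eq_zero (n := k) (by omega) (mem_primitiveSpace_iff.1 (hQ hq)).1
      (by rw [Int.toNat_natCast]; exact hk0))
  rw [← LinearMap.range_domRestrict, LinearMap.finrank_range_of_inj hinj]

/-- **The string space of a primitive family is a finite partial sum: `⊕_{k,i} eⁱQ_k = ⊕_{k < D, i ≤ k} eⁱQ_k`** for any `D ≥ dim M`.
[cite: LooijengaLunts1997, §1 (1.6) proof (arXiv p0009 L5)] -/
theorem iSup_iSup_map_pow_eq_biSup_of_le (L : HasLefschetzProperty h e) {Q : ℕ → Submodule K M} (hQ : ∀ k, Q k ≤ primitiveSpace h e k)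
    {D : ℕ} (hD : finrank K M ≤ D) :
    ⨆ k : ℕ, ⨆ i : ℕ, (Q k).map (e ^ i) = ⨆ p ∈ (range D).biUnion (fun k ↦ ({k} ×ˢ range (k + 1) : Finset (ℕ × ℕ))), (Q p.1).map (e ^ p.2) := by
  refine le_antisymm (iSup_le fun k ↦ iSup_le fun i ↦ ?_) (iSup₂_le fun p _ ↦ le_iSup_of_le p.1 (le_iSup (fun i : ℕ ↦ (Q p.1).map (e ^ i)) p.2))
  by_cases hk : k < D
  · by_cases hi : i ≤ k
    · exact le_iSup_of_le (k, i) (le_iSup_of_le (mem_biUnion₅₈.2 ⟨hk, hi⟩) le_rfl)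
    · rw [map_pow_eq_bot_of_lt_of_le (hQ k) (not_le.1 hi)]
      exact bot_le
  · rw [L.map_pow_eq_bot_of_finrank_le_of_le (hQ k) (by omega) i]
    exact bot_le

/-- **`dim ⊕_{k,i} eⁱQ_k = Σ_{k < dim M} (k + 1) dim Q_k`** — each type `k` contributes `k + 1` copies of `Q_k`.
[cite: LooijengaLunts1997, §1 (1.14) p. 7 ("M ≅ ⊕_k V(k) ⊗ P_{−k}")] [cite: GoodmanWallachGTM255, §4.1.6 Prop. 4.1.15] -/
theorem finrank_iSup_iSup_map_pow_of_le (L : HasLefschetzProperty h e) (hgr : IsZGrading h) {Q : ℕ → Submodule K M}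
    (hQ : ∀ k, Q k ≤ primitiveSpace h e k) :
    finrank K ↥(⨆ k : ℕ, ⨆ i : ℕ, (Q k).map (e ^ i)) = ∑ k ∈ range (finrank K M), (k + 1) * finrank K ↥(Q k) := by
  rw [L.iSup_iSup_map_pow_eq_biSup_of_le hQ le_rfl, finrank_biSup_eq_sum_of_iSupIndep (L.iSupIndep_map_pow_of_le hgr hQ),
    sum_biUnion (pairwiseDisjoint₅₈ _)]
  refine sum_congr rfl fun k _ ↦ ?_
  rw [sum_product, sum_singleton, sum_congr rfl fun i hi ↦ L.finrank_map_pow_of_le (hQ k) (Nat.lt_succ_iff.1 (mem_range.1 hi)), sum_const,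
    card_range, smul_eq_mul]

/-! ### §2 `w` on the blocks of a primitive family -/

/-- **`w(eⁱQ_k) ⊆ e^{k−i}Q_k`** (`w(eⁱq) = ±(i!/(k−i)!) e^{k−i}q` for `q ∈ P_{−k}`; for `i > k` the block is `0`).
[cite: Andre1996Motifs, §1.2 (p. 11)] [cite: BrockerTomDieck1985, II §5 (p0080)] -/
theorem weylOperator_mapsTo_map_pow_of_le (L : HasLefschetzProperty h e) (hgr : IsZGrading h) {Q : ℕ → Submodule K M}
    (hQ : ∀ k, Q k ≤ primitiveSpace h e k) (p : ℕ × ℕ) :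
    MapsTo (L.weylOperator hgr) ((Q p.1).map (e ^ p.2)) ((Q (p.1, p.1 - p.2).1).map (e ^ (p.1, p.1 - p.2).2)) := by
  by_cases hi : p.2 ≤ p.1
  · rintro _ ⟨q, hq, rfl⟩
    rw [SetLike.mem_coe, L.weylOperator_apply_pow_primitive hgr (hQ p.1 hq) hi]
    exact Submodule.smul_mem _ _ (Submodule.mem_map_of_mem hq)
  · intro x hx
    rw [SetLike.mem_coe, map_pow_eq_bot_of_lt_of_le (hQ p.1) (not_le.1 hi), Submodule.mem_bot] at hx
    rw [hx, map_zero]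
    exact Submodule.zero_mem _

/-- **On a fixed block `eᵐQ_{2m}` the Weyl operator is the scalar `(−1)^m`** (`eᵐQ_{2m} ⊆ eᵐP_{−2m}`).
[cite: Andre1996Motifs, §1.2 (p. 11)] [cite: BrockerTomDieck1985, II §5 (p0080)] -/
theorem weylOperator_apply_of_mem_map_pow_two_mul_of_le (L : HasLefschetzProperty h e) (hgr : IsZGrading h) {Q : Submodule K M} {m : ℕ}
    (hQ : Q ≤ primitiveSpace h e (2 * m)) {x : M} (hx : x ∈ Q.map (e ^ m)) : L.weylOperator hgr x = ((-1 : K) ^ m) • x :=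
  L.weylOperator_apply_of_mem_map_pow_primitiveSpace_two_mul hgr (Submodule.map_mono hQ hx)

/-- On a block fixed by `(k, i) ↦ (k, k − i)` (`2i = k`) the Weyl operator is the scalar `(−1)^i`. [cite: BrockerTomDieck1985, II §5 (p0080)] -/
private theorem weylOperator_apply_of_fixed₅₈ (L : HasLefschetzProperty h e) (hgr : IsZGrading h) {Q : ℕ → Submodule K M}
    (hQ : ∀ k, Q k ≤ primitiveSpace h e k) (p : ℕ × ℕ) (hfix : (p.1, p.1 - p.2) = p) (x : M) (hx : x ∈ (Q p.1).map (e ^ p.2)) :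
    L.weylOperator hgr x = ((-1 : K) ^ p.2) • x := by
  have h2 : p.1 = 2 * p.2 := by have := (Prod.ext_iff.1 hfix).2; dsimp only at this; omega
  have hQ' : Q p.1 ≤ primitiveSpace h e (2 * p.2) := h2 ▸ hQ p.1
  exact L.weylOperator_apply_of_mem_map_pow_two_mul_of_le hgr hQ' hx

/-- **The string space `⊕_{k,i} eⁱQ_k` of a primitive family is `w`-stable.** [cite: Andre1996Motifs, §1.2 (p. 11)]
[cite: LooijengaLunts1997, §1 (1.6) proof (arXiv p0009 L5)] -/
theorem weylOperator_mapsTo_iSup_iSup_map_pow_of_le (L : HasLefschetzProperty h e) (hgr : IsZGrading h) {Q : ℕ → Submodule K M}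
    (hQ : ∀ k, Q k ≤ primitiveSpace h e k) :
    MapsTo (L.weylOperator hgr) (⨆ k : ℕ, ⨆ i : ℕ, (Q k).map (e ^ i) : Submodule K M) (⨆ k : ℕ, ⨆ i : ℕ, (Q k).map (e ^ i) : Submodule K M) := by
  rw [L.iSup_iSup_map_pow_eq_biSup_of_le hQ le_rfl]
  exact mapsTo_biSup_of_mapsTo sigma_mem₅₈ (L.weylOperator_mapsTo_map_pow_of_le hgr hQ)

/-! ### §3 The trace of `w` on the string space of a primitive family -/

omit [CharZero K] [FiniteDimensional K M] in
/-- Transport of a restricted trace along an equality of subspaces. [folklore] -/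
private theorem trace_restrict_congr₅₈ {W W' : Submodule K M} (hWW' : W = W') {f : Module.End K M} (hW : MapsTo f W W) (hW' : MapsTo f W' W') :
    LinearMap.trace K ↥W (f.restrict hW) = LinearMap.trace K ↥W' (f.restrict hW') := by
  subst hWW'
  rfl

omit [CharZero K] [FiniteDimensional K M] in
/-- The fixed-point count on one string type: only `2i = k` survives, with weight `(−1)^i dim Q_k`. [cite: Serre1977, §2.1 Exercise 2.2] -/
private theorem sum_ite_fixed₅₈ (L : HasLefschetzProperty h e) {Q : ℕ → Submodule K M} (hQ : ∀ k, Q k ≤ primitiveSpace h e k) (k : ℕ) :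
    ∑ i ∈ range (k + 1), (if ((k, i).1, (k, i).1 - (k, i).2) = (k, i) then (-1 : K) ^ (k, i).2 *
        (finrank K ↥((Q (k, i).1).map (e ^ (k, i).2)) : K) else 0) =
      (if Even k then (-1 : K) ^ (k / 2) else 0) * (finrank K ↥(Q k) : K) := by
  have key : ∀ i ∈ range (k + 1), (if ((k, i).1, (k, i).1 - (k, i).2) = (k, i) then (-1 : K) ^ (k, i).2 *
      (finrank K ↥((Q (k, i).1).map (e ^ (k, i).2)) : K) else 0) = if 2 * i = k then (-1 : K) ^ i * (finrank K ↥(Q k) : K) else 0 :=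
    fun i _ ↦ by
      dsimp only
      by_cases h2 : 2 * i = k
      · rw [if_pos (show ((k, k - i) : ℕ × ℕ) = (k, i) from Prod.ext rfl (by dsimp only; omega)), if_pos h2,
          L.finrank_map_pow_of_le (hQ k) (by omega)]
      · rw [if_neg (show ¬((k, k - i) : ℕ × ℕ) = (k, i) from fun H ↦ h2 (by have := (Prod.ext_iff.1 H).2; dsimp only at this; omega)),
          if_neg h2]
  rw [sum_congr rfl key]
  rcases Nat.even_or_odd k with ⟨m, hm⟩ | ⟨m, hm⟩
  · rw [sum_eq_single_of_mem m (mem_range.2 (by omega)) (fun i _ hi ↦ if_neg (by omega)), if_pos (by omega), if_pos ⟨m, hm⟩,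
      show k / 2 = m by omega]
  · rw [sum_eq_zero (fun i _ ↦ if_neg (by omega)), if_neg (Nat.not_even_iff_odd.2 ⟨m, hm⟩), zero_mul]

/-- **THE TRACE OF THE WEYL OPERATOR ON THE STRING SPACE OF A PRIMITIVE FAMILY: `tr(w | ⊕_{k,i} eⁱQ_k) = Σ_{k < dim M} χ_k(w) dim Q_k`**,
`χ_k(w) = (−1)^{k/2}` for `k` even, `0` for `k` odd — `w` permutes the blocks `eⁱQ_k ↦ e^{k−i}Q_k`, and only the middle blocks
`eᵐQ_{2m}` (scalar `(−1)^m`, dimension `dim Q_{2m}`) are fixed. [cite: BrockerTomDieck1985, II §5 (p0080, "χ_n … has the value Σ_{k=0}^{n} e^{i(n−2k)t} at e(t)")]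
[cite: Serre1977, §2.1 Exercise 2.2 and Prop. 2 (i)] [cite: LooijengaLunts1997, §1 (1.6) proof (arXiv p0009 L5)] -/
theorem trace_weylOperator_restrict_iSup_iSup_map_pow_of_le (L : HasLefschetzProperty h e) (hgr : IsZGrading h) {Q : ℕ → Submodule K M}
    (hQ : ∀ k, Q k ≤ primitiveSpace h e k) :
    LinearMap.trace K ↥(⨆ k : ℕ, ⨆ i : ℕ, (Q k).map (e ^ i)) ((L.weylOperator hgr).restrict (L.weylOperator_mapsTo_iSup_iSup_map_pow_of_le hgr hQ)) =
      ∑ k ∈ range (finrank K M), (if Even k then (-1 : K) ^ (k / 2) else 0) * (finrank K ↥(Q k) : K) := by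
  rw [trace_restrict_congr₅₈ (L.iSup_iSup_map_pow_eq_biSup_of_le hQ le_rfl) _
    (mapsTo_biSup_of_mapsTo sigma_mem₅₈ (L.weylOperator_mapsTo_map_pow_of_le hgr hQ)),
    trace_restrict_biSup_eq_sum_ite_mul_finrank (L.iSupIndep_map_pow_of_le hgr hQ) _ sigma_mem₅₈ (L.weylOperator_mapsTo_map_pow_of_le hgr hQ)
      (c := fun p : ℕ × ℕ ↦ (-1 : K) ^ p.2) (fun p _ ↦ L.weylOperator_apply_of_fixed₅₈ hgr hQ p), sum_biUnion (pairwiseDisjoint₅₈ _)]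
  refine sum_congr rfl fun k _ ↦ ?_
  rw [sum_product, sum_singleton]
  exact L.sum_ite_fixed₅₈ hQ k

/-! ### §4 `𝔰𝔩₂`-submodules: `tr(w | N) = Σ_k χ_k(w) dim (N ∩ P_{−k})`, `dim N = Σ_k (k + 1) dim (N ∩ P_{−k})` -/

/-- **Every subspace stable under `e` and `ᶜΛ` is `w`-stable** (it is the string space of `Q_k = N ∩ P_{−k}`; equivalently `w ∈ K[e, ᶜΛ]`).
[cite: LooijengaLunts1997, §1 (1.6) proof (arXiv p0009 L5, "N = ⊕_{k≥0} ℂ[e] P_{−k}(N)")] [cite: Andre1996Motifs, §1.2 (p. 11)] -/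
theorem weylOperator_mapsTo_of_stable (L : HasLefschetzProperty h e) (hgr : IsZGrading h) {N : Submodule K M} (he : ∀ x ∈ N, e x ∈ N)
    (hf : ∀ x ∈ N, L.dual hgr x ∈ N) : MapsTo (L.weylOperator hgr) N N := by
  rw [L.eq_iSup_map_pow_inf_primitiveSpace_of_stable hgr he hf]
  exact L.weylOperator_mapsTo_iSup_iSup_map_pow_of_le hgr fun k ↦ inf_le_right

/-- **THE TRACE OF THE WEYL OPERATOR ON AN `𝔰𝔩₂`-SUBMODULE: `tr(w | N) = Σ_{k < dim M} χ_k(w) · dim (N ∩ P_{−k})`** for every subspace `N`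
stable under `e` and `ᶜΛ` (`χ_{2m}(w) = (−1)^m`, `χ_{2m+1}(w) = 0`; `dim (N ∩ P_{−k})` is the multiplicity of `V(k)` in `N`).
[cite: BrockerTomDieck1985, II §5 (p0080)] [cite: Serre1977, §2.1 Prop. 2 (i) and Exercise 2.2] [cite: LooijengaLunts1997, §1 (1.6) proof and (1.14) p. 7]
[cite: GoodmanWallachGTM255, §4.1.6 Prop. 4.1.15] -/
theorem trace_weylOperator_restrict_of_stable (L : HasLefschetzProperty h e) (hgr : IsZGrading h) {N : Submodule K M} (he : ∀ x ∈ N, e x ∈ N)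
    (hf : ∀ x ∈ N, L.dual hgr x ∈ N) :
    LinearMap.trace K ↥N ((L.weylOperator hgr).restrict (L.weylOperator_mapsTo_of_stable hgr he hf)) =
      ∑ k ∈ range (finrank K M), (if Even k then (-1 : K) ^ (k / 2) else 0) * (finrank K ↥(N ⊓ primitiveSpace h e k) : K) := by
  rw [trace_restrict_congr₅₈ (L.eq_iSup_map_pow_inf_primitiveSpace_of_stable hgr he hf) _
    (L.weylOperator_mapsTo_iSup_iSup_map_pow_of_le hgr fun k ↦ inf_le_right)]
  exact L.trace_weylOperator_restrict_iSup_iSup_map_pow_of_le hgr fun k ↦ inf_le_right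

/-- **`dim N = Σ_{k < dim M} (k + 1) dim (N ∩ P_{−k})`** for every subspace `N` stable under `e` and `ᶜΛ` (`N ≅ ⊕_k V(k) ⊗ (N ∩ P_{−k})`).
[cite: LooijengaLunts1997, §1 (1.6) proof and (1.14) p. 7] [cite: GoodmanWallachGTM255, §4.1.6 Prop. 4.1.15] -/
theorem finrank_eq_sum_of_stable (L : HasLefschetzProperty h e) (hgr : IsZGrading h) {N : Submodule K M} (he : ∀ x ∈ N, e x ∈ N)
    (hf : ∀ x ∈ N, L.dual hgr x ∈ N) : finrank K ↥N = ∑ k ∈ range (finrank K M), (k + 1) * finrank K ↥(N ⊓ primitiveSpace h e k) := by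
  conv_lhs => rw [L.eq_iSup_map_pow_inf_primitiveSpace_of_stable hgr he hf]
  exact L.finrank_iSup_iSup_map_pow_of_le hgr fun k ↦ inf_le_right

/-- **No even string type in `N` ⟹ `tr(w | N) = 0`**: if `N ∩ P_{−2m} = 0` for all `m`, the Weyl operator is traceless on `N`.
[cite: BrockerTomDieck1985, II §5 (p0080)] [cite: Serre1977, §2.1 Exercise 2.2] -/
theorem trace_weylOperator_restrict_of_stable_eq_zero (L : HasLefschetzProperty h e) (hgr : IsZGrading h) {N : Submodule K M}
    (he : ∀ x ∈ N, e x ∈ N) (hf : ∀ x ∈ N, L.dual hgr x ∈ N) (hN : ∀ m : ℕ, N ⊓ primitiveSpace h e (2 * m) = ⊥) :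
    LinearMap.trace K ↥N ((L.weylOperator hgr).restrict (L.weylOperator_mapsTo_of_stable hgr he hf)) = 0 := by
  rw [L.trace_weylOperator_restrict_of_stable hgr he hf]
  refine sum_eq_zero fun k _ ↦ ?_
  by_cases hk : Even k
  · obtain ⟨m, rfl⟩ := hk.two_dvd
    rw [hN m, finrank_bot, Nat.cast_zero, mul_zero]
  · rw [if_neg hk, zero_mul]

end HasLefschetzProperty

end Literature.Algebra.Lie
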